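import Summits.ResolutionOfSingularities.ResolutionOfSingularities.Theorems.WeightedInvariantE2LemmaHClosure
import Summits.ResolutionOfSingularities.ResolutionOfSingularities.Theorems.WeightedInvariantE2LemmaHCorePoint
import HarnessLib

/-!
# E2 centre, word (G-6b) `e2CentreHom`: **LEMMA H** — the prime of a MAXIMAL point of `closure (maxLocus₂)` is homogeneous for
# EVERY grading of EVERY affine open making the hypersurface ideal homogeneous

Route `ResolutionOfSingularities/WeightedInvariant`, crux `Theses.WeightedInvariant.HypersurfaceCentreConstruction`
(stmt-ResolutionOfSingularities-19897), door line `local-engine` (skeleton v3.12), E2 tier, registered stub `stub_e2_centre_h`, resting on the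
single word (G-6b) `PRungGrHomLE 3 p ι J → E2HomogeneousChartBody p ι J → E2CentreHomBody p ι J` (`…ELadderTwoCentreOfHom`).  The proof route
«LEMMA H» (`Cruxes/HypersurfaceCentreConstruction/G6B-LEMMA-H.md`, leafhand-res-weightedinvariant-1) reduces (G-6b) to the (G-6a) kernel
`E2Model.isHomogeneous_of_J_reading_associatedPrimes` PLUS:

**LEMMA H.** Under the graded HOM rung and (I0)₂, for a stage `S`, an affine open `W` with a `ℤʲ'`-grading `𝒜` of `Γ(S.Y, W)` making
`𝓘(X)(W)` homogeneous, and a point `η ∈ W ∩ maxLocus₂` which is MAXIMAL in `closure (maxLocus₂)` under generisation (the generic point of an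
irreducible component): the prime `𝔭_W(η)` is `𝒜`-homogeneous (`Stage.isHomogeneous_primeIdealOf_of_maximal`).

Proof (this file = the assembly; the steps are the three helper files): the `𝒜`-core point `η₁` of `η` in `W` (…E2LemmaHCorePoint: `η₁ ⤳ η`,
`ι(η₁) = ι(η) = mu₂`, `η₁ ∈ singImage`, `dim ≤ 3`), then on a UNIT chart `W a ∋ η` (hence `∋ η₁`) the core point `η₂` of `η₁` for the atlas
grading (same file: `𝔭_a(η₂)` homogeneous, `η₂ ⤳ η₁`, `ι(η₂) = mu₂`, `η₂ ∈ singImage`); by the CLAIM of …E2LemmaHClosure (Jacobson density of closed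
points, orbit-generic points over them, the (c7)≤3 sandwich of …IotaSqueezeLE) `η₂ ∈ closure (maxLocus₂)`, so maximality gives `η₂ = η`, whence
`η₁ = η` (antisymmetry of specialisation, schemes are T₀) and `𝔭_W(η) = core_𝒜 𝔭_W(η)` is homogeneous.  No constants-in-degree-`0` hypothesis is
needed.  What remains for (G-6b) is the wiring (a)+(e) of the memo: `Ass(Γ(W) ⧸ Rₙ(W))` = generic points of the components of
`closure (maxLocus₂) ∩ W` (stalkwise maximality) and the kernel's reading at the prime and its core.  Def-free helper
(`--supports stmt-ResolutionOfSingularities-19897`); nothing here asserts any clause or anything about resolution of singularities in characteristic `p`;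
AI-written, weaker than expert review. [OURS · L1 W4.3]
-/

noncomputable section

set_option linter.dupNamespace false -- mandated namespace of this single-conjunct summit

open CategoryTheory AlgebraicGeometry TopologicalSpace IsLocalRing Topology
open Literature.AlgebraicGeometry.Resolution
open Summit.ResolutionOfSingularities.ResolutionOfSingularities.Theorems
open Summit.ResolutionOfSingularities.ResolutionOfSingularities.Cruxes.HypersurfaceCentreConstruction.LocalEngine

namespace Summit.ResolutionOfSingularities.ResolutionOfSingularities.Theorems.ELadderOne.Stage

variable {k : Type} [Field k] (S : Stage k) {p : ℕ} (ι : (R : Type) → [CommRing R] → R → Ordinal.{0})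
  (J : (R : Type) → [CommRing R] → R → ℕ → Ideal R)

/-- **LEMMA H.**  Under the graded HOM rung `PRungGrHomLE 3 p ι J` and (I0)₂: for an affine open `W` of the stage, a `ℤʲ'`-grading `𝒜` of
`Γ(S.Y, W)` making `𝓘(X)(W)` homogeneous, and `η ∈ W ∩ maxLocus₂` maximal in `closure (maxLocus₂)` under generisation, the prime `𝔭_W(η)` is
`𝒜`-homogeneous. [folklore] -/
theorem isHomogeneous_primeIdealOf_of_maximal [CharP k p] [PerfectField k] (hr : PRungGrHomLE 3 p ι J) (h0 : S.InvDim₂)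
    (W : S.Y.affineOpens) {j' : ℕ} (𝒜 : (Fin j' → ℤ) → AddSubgroup Γ(S.Y, W)) [GradedRing 𝒜]
    (hXhom : (S.i.ker.ideal W).IsHomogeneous 𝒜) {η : S.Y} (hηW : η ∈ (W : S.Y.Opens)) (hη : η ∈ S.maxLocus₂ ι)
    (hmax : ∀ y' ∈ closure (S.maxLocus₂ ι), y' ⤳ η → η ⤳ y') :
    ((W.2.primeIdealOf ⟨η, hηW⟩).asIdeal).IsHomogeneous 𝒜 := by
  classical
  have hc6 : IotaIsoInvariant ι := hr.1.1
  have hc11 : IotaJEssSmoothCompatibleLE 3 ι J := hr.1.2.2.2.2.2.1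
  have hu : IotaUnitInvariant ι := hr.1.2.2.2.2.2.2.2.2.1
  obtain ⟨⟨hsing, hog, hdim⟩, hιη⟩ := hη
  -- the `𝒜`-core point `η₁` of `η` in `W`
  obtain ⟨η₁, hη₁W, -, hη₁hom, hη₁η, hdim₁, hι₁, hsing₁⟩ :=
    exists_corePoint ι J S.f S.i.ker S.isLocallyPrincipal W 𝒜 hc6 hc11 hu hXhom hηW hdim
  -- a unit chart through `η`, hence through `η₁`
  obtain ⟨x, hx⟩ := S.mem_range_of_mem_singImage hsing
  obtain ⟨a, hxa, ha⟩ := S.exists_isUnitChart x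
  have hηa : η ∈ (S.atlas.W a : S.Y.Opens) := hx ▸ hxa
  have hη₁a : η₁ ∈ (S.atlas.W a : S.Y.Opens) := hη₁η.mem_open (S.atlas.W a : S.Y.Opens).2 hηa
  -- the core point `η₂` of `η₁` for the ATLAS grading of the unit chart
  letI := S.atlas.gradedRing a
  obtain ⟨η₂, hη₂a, -, hη₂hom, hη₂η₁, -, hι₂, hsing₂⟩ :=
    exists_corePoint ι J S.f S.i.ker S.isLocallyPrincipal (S.atlas.W a) (S.atlas.piece a) hc6 hc11 hu
      (S.atlas.isHomogeneous_ker a) hη₁a (hdim₁.trans hdim)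
  -- `η₂ = η` by the CLAIM and maximality, then `η₁ = η`
  have hμ : S.mu₂ ι ≤ iotaAt ι S.i.ker η₂ := (hι₂.trans (hι₁.trans hιη)).ge
  have e2 : η₂ = η :=
    S.eq_of_isHomogeneous_of_specializes_of_maximal ι J hr h0 ha hη₂a hη₂hom hμ (hsing₂ (hsing₁ hsing))
      (hη₂η₁.trans hη₁η) hmax
  have e1 : η₁ = η := (hη₁η.antisymm (e2 ▸ hη₂η₁)).eq
  subst e1
  exact hη₁hom

/-- **LEMMA H, closure form of maximality**: the same with maximality phrased on points of `closure (maxLocus₂)` specialising FROM above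
(`η` is the generic point of its irreducible component: every point of `closure (maxLocus₂)` generising `η` IS `η`). [folklore] -/
theorem isHomogeneous_primeIdealOf_of_forall_eq [CharP k p] [PerfectField k] (hr : PRungGrHomLE 3 p ι J) (h0 : S.InvDim₂)
    (W : S.Y.affineOpens) {j' : ℕ} (𝒜 : (Fin j' → ℤ) → AddSubgroup Γ(S.Y, W)) [GradedRing 𝒜]
    (hXhom : (S.i.ker.ideal W).IsHomogeneous 𝒜) {η : S.Y} (hηW : η ∈ (W : S.Y.Opens)) (hη : η ∈ S.maxLocus₂ ι)
    (hmax : ∀ y' ∈ closure (S.maxLocus₂ ι), y' ⤳ η → y' = η) :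
    ((W.2.primeIdealOf ⟨η, hηW⟩).asIdeal).IsHomogeneous 𝒜 :=
  S.isHomogeneous_primeIdealOf_of_maximal ι J hr h0 W 𝒜 hXhom hηW hη fun y' hy' h => (hmax y' hy' h) ▸ specializes_rfl

end Summit.ResolutionOfSingularities.ResolutionOfSingularities.Theorems.ELadderOne.Stage

end
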